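import Mathlib
import HarnessLib
import Summits.HubbardSuperconductivity.HubbardSuperconductivity.Theorems.KLProgrammeKLRegimeEngineScaleZeroIsoTupleG5
import Summits.HubbardSuperconductivity.HubbardSuperconductivity.Theorems.KLProgrammeKLRegimeEngineV8IsoTupleExport
import Summits.HubbardSuperconductivity.HubbardSuperconductivity.Theorems.KLProgrammeKLRegimeEngineV8DefsU10
import Summits.HubbardSuperconductivity.HubbardSuperconductivity.Theorems.KLProgrammeKLRegimeEngineV8DefsL4

/-!
# Route `KLProgramme` — ENGINE child gen 8 (stmt-HubbardSuperconductivity-20437 `KLRegimeEngineV17F2`), SKELETON v2 class #6: the n = 0 BASE of the iso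
# fixed-tuple line BY NAME — `IsoTupleLineAt L M (klIsoT⁴/2) (klIsoT⁴·klScaleZeroValC R/192) P β U μ 0` under the binders of `stub_engine_scale0`
# (plan g18 sheet §F/J6 «isoTupleLineAt_klE5_zero», k3c2-p2 lineage; plan g19 K4: the base lives inside the class owner's ∃-proof;
# cell gate-hubbard-kl, seat hubbard-kl-k3c2-p2 g9 = class-#6 text owner)

p3's `isoTupleL1AtS_zero_of_torusSum` (…ScaleZeroIsoTuple) proves the ABSOLUTE scale-0 bound `fixedTupleL1 … 0 m Ω x₁ ≤ T̂⁴·(U/2 + ValC·U²/192)` on the way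
to (E5-S)₀ and then absorbs it into `B`.  Class #6 wants the absolute line itself (`IsoTupleLineAt`, …EngineV8IsoTupleExport); this file re-runs steps (1)–(2)
of that proof and names the result:

* **`fixedTupleL1_klIsoKernelAt_zero_le_abs`** — for every admissible frame `K` (`FrameOK R U Nsc μ K`), `R.WF`, `0 < U ≤ 1`, `klBetaMin ≤ β ≤ L`, `β³ ≤ M`,
  `klScaleZeroThetaC R·U ≤ 1/2`, the isotropic torus bound `T̂` (`hT`): `fixedTupleL1 β 3 (klIsoKernelAt … K 0 m) Ω x₁ ≤ T̂⁴·(U/2 + klScaleZeroValC R·U²/192)` for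
  EVERY resolution `m`, tuple `Ω` and pin `x₁` (no `bgmSectorSet` membership needed);
* **`isoTupleLineAt_zero_of_klEngU₀3`** — under the binders of `stub_engine_scale0` (`0 < c ≤ klEngC₃3`, `μ ∈ klWindowC`, `0 < U ≤ klEngU₀3 P R c`,
  `klBetaMin ≤ β ≤ e^{c/U²}`, `klEngL₃ β U ≤ L`, `klEngM₃ β U L ≤ M`) and `FrameOK R U (nScales β) μ (klFlowFrameU L M β U μ 0)`:
  `IsoTupleLineAt L M (klIsoT ^ 4 / 2) (klIsoT ^ 4 * klScaleZeroValC R / 192) P β U μ 0` (`T̂ := klIsoT` via `TorusFourierL2.exists_isoTorusBoundAt`,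
  `θ`-smallness via `klScaleZeroThetaC_mul_le_half_of_le_klEngU₀3`; `Klam ≥ 1` turns `U²` into `(Klam U)²`); the v2 doors follow by `klEngU₀10 ≤ klEngU₀3`,
  `klEngL₃ ≤ klEngL₄` (`isoTupleLineAt_zero_of_klEngU₀10`).

Everything is proved; no definitions, no named facts. [cite: BenfattoGiulianiMastropietro2006, §2.6 (2.81)]
-/

noncomputable section

namespace Summit.HubbardSuperconductivity.HubbardSuperconductivity.Theorems.EngineV8

set_option linter.dupNamespace false -- summit = problem name (single-conjunct summit), D-0017

open Real Finset Literature.MathematicalPhysics.QuantumLattice Literature.Probability.LatticeModels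
open Literature.MathematicalPhysics.QuantumLattice.GrassmannAlgebra
open Summit.HubbardSuperconductivity.HubbardSuperconductivity.Theorems.KLRegimeSplit
open Summit.HubbardSuperconductivity.HubbardSuperconductivity.Theorems.KLProgrammeLegKernels
open Summit.HubbardSuperconductivity.HubbardSuperconductivity.Theorems.ScaleZeroDecay
open scoped ComplexConjugate

variable {L M : ℕ} [NeZero L]

/-- **The ABSOLUTE scale-0 fixed-tuple bound** (steps (1)–(2) of `isoTupleL1AtS_zero_of_torusSum`, before the `B`-absorption): for every resolution `m`,
every iso tuple `Ω` and pin `x₁`, `fixedTupleL1 β 3 (klIsoKernelAt … K 0 m) Ω x₁ ≤ T̂⁴·(U/2 + klScaleZeroValC R·U²/192)`.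
[cite: BenfattoGiulianiMastropietro2006, §2.6 (2.81)] -/
theorem fixedTupleL1_klIsoKernelAt_zero_le_abs [NeZero M] {P : SplitConsts} {R : RenConsts} (hR : R.WF)
    {U : ℝ} (hU : 0 < U) (hU1 : U ≤ 1) {Nsc : ℕ} {μ : ℝ} {K : TrigPolyC4v} (hK : FrameOK R U Nsc μ K)
    {β : ℝ} (hβ : klBetaMin ≤ β) (hβL : β ≤ L) (hβM : β ^ 3 ≤ (M : ℝ))
    (hθ : klScaleZeroThetaC R * U ≤ 1 / 2)
    {Th : ℝ} (hTh0 : 0 ≤ Th)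
    (hT : ∀ (m : ℕ) (ω : Fin (sectorCount (2 * m))) (c : Fin 2), 1 / (|β| * (L : ℝ) ^ 2) *
        ∑ dw : TorusSite 1 (2 * (2 * M)) × TorusSite 2 L, ‖∑ k : FreqMomentum L M, klIsoFamily L M β μ K klE0 m ω k *
          (if c = 0 then torusChar (fun _ : Fin 1 => ((k.1 : ℕ) : ZMod (2 * (2 * M)))) dw.1 * torusChar k.2 dw.2
            else conj (torusChar (fun _ : Fin 1 => ((k.1 : ℕ) : ZMod (2 * (2 * M)))) dw.1 * torusChar k.2 dw.2))‖ ≤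
        Th / imagTimeWeight β M)
    (m : ℕ) (Ω : Fin 4 → SectorLeg (sectorCount (2 * m))) (x₁ : SpaceTimeIdx L M) :
    fixedTupleL1 L M β 3 (klIsoKernelAt L M β U μ K 0 m) Ω x₁ ≤ Th ^ 4 * (U / 2 + klScaleZeroValC R * U ^ 2 / 192) := by
  have _ := P
  haveI : NeZero (2 * (2 * M)) := ⟨by have := NeZero.ne M; omega⟩
  have hβ0 : 0 < β := beta_pos_of_klBetaMin_le hβ
  have hN0 : 0 < (((2 * (2 * M) : ℕ) : ℝ)) := by exact_mod_cast Nat.pos_of_ne_zero (NeZero.ne (2 * (2 * M)))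
  have hNgr : (((2 * (2 * M) : ℕ) : ℝ)) = 4 * M := by push_cast; ring
  have hM0 : (0 : ℝ) < M := by exact_mod_cast Nat.pos_of_ne_zero (NeZero.ne M)
  have hUabs : |U| = U := abs_of_pos hU
  have hU1' : |U| ≤ 1 := by rwa [hUabs]
  have hG0 : 0 ≤ R.Gfr 0 := hR.2.2 0
  have hκ : 0 < Real.sqrt (2 * (7 + 6047)) := Real.sqrt_pos.2 (by norm_num)
  have hε : 0 < imagTimeWeight β M := by rw [imagTimeWeight]; positivity
  -- the step data (as in `…ScaleZeroValuesExplicit`)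
  have hαpos : 0 < (((2 * (2 * M) : ℕ) : ℝ)) / β * klScaleZeroA0 := by have := klScaleZeroA0_pos; positivity
  have hrow := fun X => rowSum_scaleZero_le_A0 (L := L) (μ := μ) hK hβ hβM X
  have hcol := fun Y => colSum_scaleZero_le_A0 (L := L) (μ := μ) hK hβ hβM Y
  have hkKframe : ∑ z : TorusSite 2 L, ‖framePosKernel L K z‖ ≤ klKappaFrameC R * |U| :=
    sum_norm_framePosKernel_le_linear_of_frameOK hR hU.ne' hU1' hK
  have hN₁0 : 0 ≤ |β| / (2 * (2 * M) : ℕ) * (klKappaFrameC R * |U|) := by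
    have := (klKappaFrameC_pos hG0).le; positivity
  have hct : ∀ (j : Fin 2) (w : GridLeg (GridPoint L (2 * (2 * M)))),
      ∑ Y ∈ univ.filter (fun Y : Fin 2 → GridLeg (GridPoint L (2 * (2 * M))) => Y j = w),
        ‖kernel ℂ (hubbardGridCounterQuadratic L (2 * (2 * M)) β K) 2 Y‖ ≤
          |β| / (2 * (2 * M) : ℕ) * (klKappaFrameC R * |U|) := fun j w =>
    (sum_norm_kernel_hubbardGridCounterQuadratic_le_l1 β K j w).trans (mul_le_mul_of_nonneg_left hkKframe (by positivity))
  obtain ⟨-, hθ1, hrem⟩ := scaleZero_remainder_le (L := L) (M := M) hR hU hβ0 hθ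
  -- (1) the fixed-tuple Young bound with `T := T̂/ε_x`
  have hT0 : 0 ≤ Th / imagTimeWeight β M := div_nonneg hTh0 hε.le
  have hfix := fixedTupleL1_klIsoKernelAt_zero_le_of_torusSum (L := L) (M := M) hβ0 U μ K hκ
    (isGramBoundedR_scaleZero_of_frameOK_sharp hK hβ hβL) hαpos hrow hcol hκ hN₁0 hct hθ1 m hT0 (hT m) Ω x₁
  -- (2) `(ε·T̂/ε)³·(T̂/ε)·(Uβ/N + r) ≤ T̂⁴·(U/2 + ValC·U²/192)`
  set r : ℝ := (Real.sqrt (2 * (7 + 6047)))⁻¹ ^ 4 *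
            (Real.exp 1 * normV (GridLeg (GridPoint L (2 * (2 * M)))) (Real.sqrt (2 * (7 + 6047))) (Real.sqrt (2 * (7 + 6047)))
            (fun m' : ℕ => if m' = 1 then |β| / (2 * (2 * M) : ℕ) * (klKappaFrameC R * |U|)
              else if m' = 2 then |U| * |β| / (2 * (2 * M) : ℕ) else 0)) *
          (Real.exp 1 * ((((2 * (2 * M) : ℕ) : ℝ)) / β * klScaleZeroA0) *
          normV (GridLeg (GridPoint L (2 * (2 * M)))) (Real.sqrt (2 * (7 + 6047))) (Real.sqrt (2 * (7 + 6047)))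
            (fun m' : ℕ => if m' = 1 then |β| / (2 * (2 * M) : ℕ) * (klKappaFrameC R * |U|)
              else if m' = 2 then |U| * |β| / (2 * (2 * M) : ℕ) else 0) / Real.sqrt (2 * (7 + 6047)) ^ 2) /
          (1 - Real.exp 1 * ((((2 * (2 * M) : ℕ) : ℝ)) / β * klScaleZeroA0) *
          normV (GridLeg (GridPoint L (2 * (2 * M)))) (Real.sqrt (2 * (7 + 6047))) (Real.sqrt (2 * (7 + 6047)))
            (fun m' : ℕ => if m' = 1 then |β| / (2 * (2 * M) : ℕ) * (klKappaFrameC R * |U|)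
              else if m' = 2 then |U| * |β| / (2 * (2 * M) : ℕ) else 0) / Real.sqrt (2 * (7 + 6047)) ^ 2) with hr
  have hεT : imagTimeWeight β M * (Th / imagTimeWeight β M) = Th := mul_div_cancel₀ Th hε.ne'
  rw [hεT] at hfix
  have hkey : Th / imagTimeWeight β M * (|U| * |β| / (2 * (2 * M) : ℕ) + r) ≤
      Th * (U / 2 + klScaleZeroValC R * U ^ 2 / 192) := by
    have h1 : Th / imagTimeWeight β M * (|U| * |β| / (2 * (2 * M) : ℕ) + r) =
        Th * (U / 2 + ((((2 * (2 * M) : ℕ) : ℝ)) / β * r) / 2) := by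
      rw [imagTimeWeight, hUabs, abs_of_pos hβ0, hNgr]
      field_simp
      ring
    rw [h1]
    refine mul_le_mul_of_nonneg_left ?_ hTh0
    linarith
  calc fixedTupleL1 L M β 3 (klIsoKernelAt L M β U μ K 0 m) Ω x₁
      ≤ Th ^ 3 * (Th / imagTimeWeight β M) * (|U| * |β| / (2 * (2 * M) : ℕ) + r) := hfix
    _ = Th ^ 3 * (Th / imagTimeWeight β M * (|U| * |β| / (2 * (2 * M) : ℕ) + r)) := by ring
    _ ≤ Th ^ 3 * (Th * (U / 2 + klScaleZeroValC R * U ^ 2 / 192)) := mul_le_mul_of_nonneg_left hkey (pow_nonneg hTh0 3)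
    _ = Th ^ 4 * (U / 2 + klScaleZeroValC R * U ^ 2 / 192) := by ring

/-- **The class-#6 base at n = 0 under the binders of `stub_engine_scale0`** (v1 doors `klEngU₀3`/`klEngL₃`): for the engine's scale-0 frame
`K₀ = klFlowFrameU L M β U μ 0` (admissible by hypothesis, as in the stub), `IsoTupleLineAt L M (klIsoT⁴/2) (klIsoT⁴·klScaleZeroValC R/192) P β U μ 0`.
[cite: BenfattoGiulianiMastropietro2006, §2.6 (2.81)] -/
theorem isoTupleLineAt_zero_of_klEngU₀3 [NeZero M] (P : SplitConsts) (R : RenConsts) (c : ℝ) (hP : P.WF) (hR : R.WF2) (hc : 0 < c)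
    (hc₃ : c ≤ klEngC₃3 P R) (μ : ℝ) (hμ : μ ∈ klWindowC) (U : ℝ) (hU : 0 < U) (hU₀ : U ≤ klEngU₀3 P R c) (β : ℝ)
    (hβ : klBetaMin ≤ β) (hβc : β ≤ Real.exp (c / U ^ 2)) (hL : klEngL₃ β U ≤ L) (hM : klEngM₃ β U L ≤ M)
    (hK : FrameOK R U (nScales β) μ (klFlowFrameU L M β U μ 0)) :
    IsoTupleLineAt L M (klIsoT ^ 4 / 2) (klIsoT ^ 4 * klScaleZeroValC R / 192) P β U μ 0 := by
  intro m _ Ω _ x₁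
  obtain ⟨T, h0, h⟩ := TorusFourierL2.exists_isoTorusBoundAt
  have hT := isoTorusBoundAt_klIsoT h0 h P R c hP hR hc hc₃ μ hμ U hU hU₀ β hβ hβc (klFlowFrameU L M β U μ 0) hK L M hL hM
  have h := fixedTupleL1_klIsoKernelAt_zero_le_abs (P := P) hR.wf hU (le_one_of_le_klEngU₀3 hU₀) hK hβ (le_of_klEngL₃_le hL)
    (pow_three_le_of_klEng hβ hL hM) (klScaleZeroThetaC_mul_le_half_of_le_klEngU₀3 hR.wf hU hU₀) klIsoT_nonneg hT m Ω x₁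
  refine h.trans ?_
  -- `U² ≤ (Klam U)²` (`Klam ≥ 1`)
  have hK1 : 1 ≤ P.Klam := hP.1
  have hV0 : 0 ≤ klScaleZeroValC R := (klScaleZeroValC_pos (hR.wf.2.2 0)).le
  have hT4 : 0 ≤ klIsoT ^ 4 := pow_nonneg klIsoT_nonneg 4
  have hsq : U ^ 2 ≤ (P.Klam * U) ^ 2 := by
    rw [mul_pow]; nlinarith [sq_nonneg U, one_le_pow₀ (n := 2) hK1]
  have h1 : klIsoT ^ 4 * (klScaleZeroValC R * U ^ 2 / 192) ≤ klIsoT ^ 4 * klScaleZeroValC R / 192 * (P.Klam * U) ^ 2 := by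
    have := mul_le_mul_of_nonneg_left hsq (mul_nonneg hT4 hV0)
    nlinarith
  nlinarith

/-- **The same under the v2 doors** (`U ≤ klEngU₀10 P R c ≤ klEngU₀3`, `klEngL₄ P R β U ≤ L ⇒ klEngL₃ ≤ L`): the n = 0 base the class-#6 ∃-proof reads. -/
theorem isoTupleLineAt_zero_of_klEngU₀10 [NeZero M] (P : SplitConsts) (R : RenConsts) (c : ℝ) (hP : P.WF) (hR : R.WF2) (hc : 0 < c)
    (hc₃ : c ≤ klEngC₃3 P R) (μ : ℝ) (hμ : μ ∈ klWindowC) (U : ℝ) (hU : 0 < U) (hU₀ : U ≤ klEngU₀10 P R c) (β : ℝ)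
    (hβ : klBetaMin ≤ β) (hβc : β ≤ Real.exp (c / U ^ 2)) (hL : klEngL₄ P R β U ≤ L) (hM : klEngM₃ β U L ≤ M)
    (hK : FrameOK R U (nScales β) μ (klFlowFrameU L M β U μ 0)) :
    IsoTupleLineAt L M (klIsoT ^ 4 / 2) (klIsoT ^ 4 * klScaleZeroValC R / 192) P β U μ 0 :=
  isoTupleLineAt_zero_of_klEngU₀3 P R c hP hR hc hc₃ μ hμ U hU (hU₀.trans (klEngU₀10_le_klEngU₀3 P R c)) β hβ hβc
    (klEngL₃_le_of_klEngL₄_le hL) hM hK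

end Summit.HubbardSuperconductivity.HubbardSuperconductivity.Theorems.EngineV8

end
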